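import Literature.AlgebraicTopology.SingularHomology.TransverseDiscFunctionalComparison
import Literature.AlgebraicTopology.SingularHomology.RelClassSignConstancy
import HarnessLib

/-!
# The transverse disc functional at one crossing sees only the local class there; signs of a
# relative class along an abstract open Euclidean piece (Milnor 1965, proof of Thm. 7.6, p. 52)

Topic `Literature/AlgebraicTopology/SingularHomology`; bricks for the last hypothesis `HSgn` (the
sign of one docking is `+1`) of Milnor's Basis Theorem 7.6 on a slab
(`Literature.Topology.FourManifolds.Cobordism.Milnor1965_basisTheorem_slab_of_crossingSign`,
`HCobordismSlideStepCrossingValue.lean`; named fact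
`Literature.Topology.FourManifolds.Cobordism.Milnor1965_basisTheorem_slab`).  There the classes of
the two slid discs `D_L'(p₁)^ρ`, `D_L'(p₁)^{ρ r}` (the two dockings) are compared through the
pieces the two discs have in common — the part of the old disc `D_L(p₁)` above the band, which
contains the centre `p₁`, and the Euclidean crossing charts — by transporting local orientations.
Two generic statements about a transverse disc datum `D` on `X` (stratum `P`, functional
`Λ : Hₖ(X, A) → Hₖ(D | m 0)`) and relative classes are isolated here:

* `TransverseDiscDatum.functional_map_eq_of_toLocal_eq_map` — **`Λ(φ⁎ σ)` only sees the local
  class of `σ` at the unique crossing point, and that through any open piece**: if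
  `φ : (T, B) → (X, A)` meets `P` exactly at `v`, `ι : O → T` is injective with `ι o = v`, and
  the localisation of `σ ∈ Hₖ(T, B)` at `v` is `ι⁎ m` for a class `m ∈ Hₖ(O | o)`, then
  `Λ(φ⁎ σ) = ((φ ∘ ι)⁎ ≫ exc⁻¹ ≫ ret⁎)(m)` — an expression in `φ ∘ ι : O → X` and `m` alone
  (Hatcher 2002, §3.3 p. 233, localisation; Milnor 1965, PDF p. 50, *"an easily proved relative
  version of Lemma 6.3"*);
* `exists_units_relLocalFamily_eq_smul_map` — the form of
  `Literature.AlgebraicTopology.SingularHomology.exists_units_relLocalFamily_eq_smul`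
  (`RelClassSignConstancy.lean`) for an ABSTRACT open embedding `ι : O → T` of a preconnected
  topological `k`-manifold `O` (instead of an open subset of `T`): for `w ∈ Hₖ(T, B)` whose
  local images generate along `ι(O) ⊆ T ∖ B` and an orientation `μ` of `O`, there is one sign
  `ε = ±1` with `w|_{ι o} = ε • ι⁎ μ_o` for all `o` (Hatcher 2002, §3.3 pp. 233–236,
  Lemma 3.27).

Everything here is proved; no definitions, no named facts.

## References

* J. Milnor, *Lectures on the h-cobordism theorem*, notes by L. Siebenmann and J. Sondow,
  Princeton Mathematical Notes (1965), proof of Thm. 7.6 (PDF pp. 50–52), Lemma 6.3 (PDF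
  p. 37).  Held: `lit read book:milnornd-lectures-h-cobordism-theorem`. [MilnorHCobordism1965]
* A. Hatcher, *Algebraic Topology*, CUP 2002, Thm. 2.20, §3.3 pp. 231–236 (local homology,
  local consistency, Lemma 3.27). [HatcherAT2002]
-/

noncomputable section

open CategoryTheory Set Function Filter Topology

universe u

namespace Literature.AlgebraicTopology.SingularHomology

/-! ### `Λ(φ⁎ σ)` through the local class at the unique crossing point -/

namespace TransverseDiscDatum

variable {X : Type u} [TopologicalSpace X] {k : ℕ} (D : TransverseDiscDatum X k)

omit D in
/-- A map meeting `P` exactly at `v` is a map of pairs `(T, T ∖ v) → (X, X ∖ P)`. [folklore] -/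
theorem mapsTo_compl_of_eq_singleton {T : Type u} [TopologicalSpace T] {φ : C(T, X)} {P : Set X}
    {v : T} (hF : {t | φ t ∈ P} = ({v} : Set T)) : MapsTo φ ({v}ᶜ : Set T) Pᶜ := by
  intro t ht hP
  have h : t ∈ ({v} : Set T) := by rw [← hF]; exact hP
  exact ht h

omit D in
/-- If `φ` meets `P` exactly at `ι o` and `ι` is injective, `φ ∘ ι` is a map of pairs
`(O, O ∖ o) → (X, X ∖ P)`. [folklore] -/
theorem mapsTo_comp_compl_of_eq_singleton {T : Type u} [TopologicalSpace T] {φ : C(T, X)}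
    {P : Set X} {O : Type u} [TopologicalSpace O] {ι : C(O, T)} (hι : Injective ι) {o : O} {v : T}
    (ho : ι o = v) (hF : {t | φ t ∈ P} = ({v} : Set T)) :
    MapsTo (φ.comp ι) ({o}ᶜ : Set O) Pᶜ := fun _ ho' hP =>
  mapsTo_compl_of_eq_singleton hF (mapsTo_compl_singleton_of_injective hι ho ho') hP

/-- **`Λ(φ⁎ σ)` only sees the local class of `σ` at the unique crossing point, through any
piece through it.**  Let `φ : (T, B) → (X, A)` be a map of pairs (`A ⊆ X ∖ P`) meeting the
stratum `P` exactly at `v`, `ι : O → T` injective and continuous with `ι o = v`, and suppose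
the localisation of `σ ∈ Hₖ(T, B)` at `v` is `ι⁎ m`, `m ∈ Hₖ(O | o)`.  Then
`Λ(φ⁎ σ) = ret⁎ (exc⁻¹ ((φ ∘ ι)⁎ m))`: the functional localises at `P`
(`Hₖ(X, A) → Hₖ(X | P)`), where `φ⁎ σ` becomes `φ⁎ (σ|_v) = (φ ∘ ι)⁎ m`.
[cite: HatcherAT2002, §3.3 p. 233, Thm. 2.20; MilnorHCobordism1965, proof of Thm. 7.6 (PDF p. 50)] -/
theorem functional_map_eq_of_toLocal_eq_map {A : Set X} (hA : A ⊆ D.Pᶜ) {T : Type u}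
    [TopologicalSpace T] (φ : C(T, X)) {B : Set T} (hB : MapsTo φ B A) {v : T}
    (hF : {t | φ t ∈ D.P} = ({v} : Set T)) {O : Type u} [TopologicalSpace O] (ι : C(O, T))
    (hι : Injective ι) {o : O} (ho : ι o = v) (σ : relativeSingularHomology ℤ ℤ T B k)
    (m : localHomology ℤ ℤ O o k)
    (hσ : relativeSingularHomology.map ℤ ℤ (ContinuousMap.id T)
        (D.mapsTo_id_compl_of_eq_singleton hB hA hF) k σ =
      relativeSingularHomology.map ℤ ℤ ι (mapsTo_compl_singleton_of_injective hι ho) k m) :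
    D.functional hA k (relativeSingularHomology.map ℤ ℤ φ hB k σ) =
      relativeSingularHomology.map ℤ ℤ D.ret D.mapsTo_ret k
        (inv (D.exc k) (relativeSingularHomology.map ℤ ℤ (φ.comp ι)
          (mapsTo_comp_compl_of_eq_singleton hι ho hF) k m)) := by
  have hφv : MapsTo φ ({v}ᶜ : Set T) D.Pᶜ := mapsTo_compl_of_eq_singleton hF
  -- localise: `loc (φ⁎ σ) = φ⁎ (σ|_v) = (φ ∘ ι)⁎ m`
  have h1 : D.loc hA k (relativeSingularHomology.map ℤ ℤ φ hB k σ) =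
      relativeSingularHomology.map ℤ ℤ φ hφv k
        (relativeSingularHomology.map ℤ ℤ (ContinuousMap.id T)
          (D.mapsTo_id_compl_of_eq_singleton hB hA hF) k σ) := by
    rw [loc, ← ModuleCat.comp_apply, ← relativeSingularHomology.map_comp, ← ModuleCat.comp_apply,
      ← relativeSingularHomology.map_comp]
    rfl
  have h2 : relativeSingularHomology.map ℤ ℤ φ hφv k
      (relativeSingularHomology.map ℤ ℤ ι (mapsTo_compl_singleton_of_injective hι ho) k m) =
      relativeSingularHomology.map ℤ ℤ (φ.comp ι) (mapsTo_comp_compl_of_eq_singleton hι ho hF) k m := by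
    rw [← ModuleCat.comp_apply, ← relativeSingularHomology.map_comp]
  show (D.loc hA k ≫ inv (D.exc k) ≫ relativeSingularHomology.map ℤ ℤ D.ret D.mapsTo_ret k)
      (relativeSingularHomology.map ℤ ℤ φ hB k σ) = _
  rw [ModuleCat.comp_apply, ModuleCat.comp_apply, h1, hσ, h2]

end TransverseDiscDatum

/-! ### Signs of a relative class along an abstract open Euclidean piece -/

/-- **The local images of a relative class along an open embedded manifold piece have a
constant sign against any orientation of the piece** — `exists_units_relLocalFamily_eq_smul`
for an abstract open embedding.  Let `T` be Hausdorff, `B ⊆ T`, `w ∈ Hₖ(T, B; ℤ)`, `O` a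
Hausdorff preconnected space with a `ChartedSpace ℝᵏ O` structure, `ι : O → T` an open
embedding with `ι(O) ⊆ T ∖ B`, `μ` a `ℤ`-orientation of `O`, and suppose `w|_{ι o}` generates
`Hₖ(T | ι o)` for every `o`.  Then for one sign `ε = ±1`: `w|_{ι o} = ε • ι⁎ μ_o` for all
`o : O`.  Proof: as in `RelClassSignConstancy.lean` — pull the family of local images back to
`O` along `ι` (`localHomology.isIso_map_of_isOpenEmbedding_of_eq`; consistent on compact
neighbourhoods, `LocalFamily.ConsistentOn.preimage_of_isOpenEmbedding`), compare with `μ`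
pointwise, and the sign is locally constant (`LocalFamily.sign_eq_of_isPreconnected`).
[cite: HatcherAT2002, §3.3 pp. 233–236, Lemma 3.27; MilnorHCobordism1965, proof of Thm. 7.6 (PDF p. 52)] -/
theorem exists_units_relLocalFamily_eq_smul_map {k : ℕ} {T : Type u} [TopologicalSpace T]
    [T2Space T] {B : Set T} {O : Type u} [TopologicalSpace O] [T2Space O]
    [ChartedSpace (EuclideanSpace ℝ (Fin k)) O] (hOc : IsPreconnected (univ : Set O))
    (ι : C(O, T)) (hι : IsOpenEmbedding ι) (hιB : ∀ o, ι o ∈ Bᶜ)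
    (w : relativeSingularHomology ℤ ℤ T B k) (μ : HomologicalOrientation ℤ O k)
    (hgen : ∀ o : O, ∃ e : localHomology ℤ ℤ T (ι o) k ≃ₗ[ℤ] ℤ, e (relLocalFamily w (ι o)) = 1) :
    ∃ ε : ℤˣ, ∀ o : O, relLocalFamily w (ι o) =
      (ε : ℤ) • relativeSingularHomology.map ℤ ℤ ι (LocalFamily.mapsTo_compl_pt hι.injective o) k
        (μ.localClass o) := by
  classical
  -- the isomorphisms `ι⁎ : Hₖ(O | o) ≅ Hₖ(T | ι o)`
  have hiso : ∀ o : O, IsIso (relativeSingularHomology.map ℤ ℤ ι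
      (LocalFamily.mapsTo_compl_pt hι.injective o) k) := fun o =>
    localHomology.isIso_map_of_isOpenEmbedding_of_eq ℤ ℤ ι hι o rfl k
  set β : LocalFamily ℤ ℤ O k := fun o => μ.localClass o with hβ
  set β' : LocalFamily ℤ ℤ O k := fun o =>
    inv (relativeSingularHomology.map ℤ ℤ ι (LocalFamily.mapsTo_compl_pt hι.injective o) k)
      (relLocalFamily w (ι o)) with hβ'
  have hββ' : ∀ o : O, relLocalFamily w (ι o) =
      relativeSingularHomology.map ℤ ℤ ι (LocalFamily.mapsTo_compl_pt hι.injective o) k (β' o) := by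
    intro o
    haveI := hiso o
    show relLocalFamily w (ι o) = (inv (relativeSingularHomology.map ℤ ℤ ι
      (LocalFamily.mapsTo_compl_pt hι.injective o) k) ≫ relativeSingularHomology.map ℤ ℤ ι
        (LocalFamily.mapsTo_compl_pt hι.injective o) k) (relLocalFamily w (ι o))
    rw [IsIso.inv_hom_id, ModuleCat.id_apply]
  -- `β'` is consistent near every point
  haveI : LocallyCompactSpace O := ChartedSpace.locallyCompactSpace (EuclideanSpace ℝ (Fin k)) O
  have hβ'cons : ∀ o : O, ∃ N ∈ 𝓝 o, β'.ConsistentOn N := by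
    intro o
    obtain ⟨K, hKc, hKo⟩ := exists_compact_mem_nhds o
    refine ⟨K, hKo, ?_⟩
    have himg : IsCompact (ι '' K) := hKc.image ι.continuous
    have hcl : closure (ι '' K) ⊆ range ι := by
      rw [himg.isClosed.closure_eq]
      rintro _ ⟨o', -, rfl⟩
      exact ⟨o', rfl⟩
    have hKB : ι '' K ⊆ Bᶜ := by
      rintro _ ⟨o', -, rfl⟩
      exact hιB o'
    exact LocalFamily.ConsistentOn.preimage_of_isOpenEmbedding ι hι hcl
      (consistentOn_relLocalFamily w hKB) (fun o' _ => hββ' o')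
  -- `β` is consistent near every point and generates; so does `β'`
  have hβcons : ∀ o : O, ∃ N ∈ 𝓝 o, β.ConsistentOn N := fun o => μ.consistentOn_nhds o
  have hβgen : ∀ o : O, ∃ e : localHomology ℤ ℤ O o k ≃ₗ[ℤ] ℤ, e (β o) = 1 := fun o => μ.isGenerator o
  have hβ'gen : ∀ o : O, ∃ e : localHomology ℤ ℤ O o k ≃ₗ[ℤ] ℤ, e (β' o) = 1 := by
    intro o
    haveI := hiso o
    exact exists_linearEquiv_apply_eq_one_of_linearEquiv
      (asIso (relativeSingularHomology.map ℤ ℤ ι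
        (LocalFamily.mapsTo_compl_pt hι.injective o) k)).symm.toLinearEquiv (hgen o)
  set ε : O → ℤˣ := fun o => if β' o = β o then 1 else -1 with hεdef
  have hε : ∀ o ∈ (univ : Set O), β' o = (ε o : ℤ) • β o := by
    intro o _
    by_cases h : β' o = β o
    · rw [hεdef]; simp only [h, if_true, Units.val_one, one_smul]
    · have h' : β' o = -β o := (eq_or_eq_neg_of_isGenerator (hβ'gen o) (hβgen o)).resolve_left h
      rw [hεdef]; simp only [h, if_false, Units.val_neg, Units.val_one, neg_one_zsmul]
      exact h'
  have hε' : ∀ o ∈ (univ : Set O), β' o =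
      @HSMul.hSMul ℤ _ _ (@instHSMul ℤ _ Module.toDistribMulAction.toDistribSMul.toSMul) (ε o : ℤ) (β o) := by
    intro o ho
    exact (hε o ho).trans (int_smul_eq_zsmul _ _ _).symm
  have hconst : ∀ o o' : O, ε o = ε o' := fun o o' =>
    LocalFamily.sign_eq_of_isPreconnected (EuclideanSpace ℝ (Fin k)) isOpen_univ hOc
      (fun x _ => hβcons x) (fun x _ => hβ'cons x) (fun x _ => hβgen x) hε' (mem_univ o) (mem_univ o')
  rcases isEmpty_or_nonempty O with hOe | ⟨⟨o₀⟩⟩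
  · exact ⟨1, fun o => (hOe.false o).elim⟩
  refine ⟨ε o₀, fun o => ?_⟩
  have h1 : β' o = (ε o₀ : ℤ) • β o := by rw [← hconst o o₀]; exact hε o (mem_univ o)
  rw [hββ' o, h1, map_zsmul]

end Literature.AlgebraicTopology.SingularHomology

end
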